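import Literature.AlgebraicGeometry.Frobenioids.EquivalenceGroupLikeQuasiIsotropic
import Literature.AlgebraicGeometry.Frobenioids.BaseCategoryTheoreticity
import HarnessLib

/-!
# Frobenioids I, §3: Theorem 3.4 (ii), (iii) — the typed statements on the GROUP-LIKE-TYPE branch

Mochizuki, *The geometry of Frobenioids I: the general theory*, Kyushu J. Math. **62** (2008),
Thm. 3.4 (ii), (iii), kurims p. 62, proof pp. 63–65 [cite: MochizukiFrdI2008, Thm. 3.4 (iii) p.62].

PROOF-ONLY sequel of `EquivalenceGroupLikeQuasiIsotropic.lean` (abc-iut cell, WAVE-4 discharge prover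
abc-iut-w4-d088; node `FrdI:Thm3.4(iii)` / sub-node `L01g` of `plan/L1/SUBDAG-FrdI-Thm34.md`). For
Frobenioids `C₁`, `C₂` BOTH OF GROUP-LIKE TYPE the typed conclusion predicates of the §3 statement file
`BaseCategoryTheoreticity.lean` (abc-iut-L1-t3) hold LITERALLY, at the operations
`PreFrobenioidData.ofFunctor Φ_i F_i`, with no hypothesis on the bases beyond what the typed statements
themselves carry:
* `thm34ii_ofFunctor_of_isOfGroupLikeType : (ofFunctor Φ₁ F₁).Thm34ii (ofFunctor Φ₂ F₂) Ψ` — in group-like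
  type every pre-step is isometric, hence carried to an (isometric) pre-step by Thm. 3.4 (i) (Prop. 1.9
  (vii), `FrdI.isIsometry_isPreStep_map`); a co-angular isometric pre-step is an isomorphism (test
  factorisation `𝟙 ≫ φ ≫ 𝟙`), and isomorphisms are co-angular pre-steps in a totally epimorphic category;
  every object of `C₂` is group-like. (The printed proof, p. 63, runs through Prop. 1.14 (ii), (iii) over
  FSMFF-type bases; on the group-like branch none of this is needed — "all pre-steps of `C₁`, `C₂` are
  isomorphisms", p. 65, up to isotropic hulls.)
* `thm34iii_ofFunctor_of_isOfGroupLikeType : (ofFunctor Φ₁ F₁).Thm34iii (ofFunctor Φ₂ F₂) Ψ` — standard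
  type (a) supplies quasi-isotropic type and hypothesis (b) `HypB` supplies "`Ψ`, `Ψ⁻¹` preserve
  base-isomorphisms"; the rest is `FrdI.thm34iii_of_isOfGroupLikeType_of_hypB`.
The named facts `FrdI.Thm34ii`, `FrdI.Thm34iii` (`CategoryTheoreticityFacts.lean`) quantify over ALL
Frobenioids; this file closes their group-like-type branch only (the other branch: abc-iut-L1-t13's
FSM-type files and the residual recorded in `plan/GAP-LEDGER.md`). No statement of the paper is restated
or strengthened; nothing here bears on [IUTchIII] Cor. 3.12.
-/

set_option backward.isDefEq.respectTransparency false

namespace Literature.AlgebraicGeometry.Frobenioids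

open CategoryTheory Opposite

universe w v v' u u'

namespace FrdI

section Two

variable {D₁ : Type u} [Category.{v} D₁] {Φ₁ : D₁ᵒᵖ ⥤ CommMonCat.{w}} {C₁ : Type u'}
  [Category.{v'} C₁] {D₂ : Type u} [Category.{v} D₂] {Φ₂ : D₂ᵒᵖ ⥤ CommMonCat.{w}} {C₂ : Type u'}
  [Category.{v'} C₂] {F₁ : C₁ ⥤ ElemFrobenioid Φ₁} {F₂ : C₂ ⥤ ElemFrobenioid Φ₂}

/-- A co-angular pre-step out of a group-like object is an isomorphism: it is an isometric pre-step, and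
co-angularity applied to the factorisation `𝟙 ≫ φ ≫ 𝟙` makes it invertible.
[cite: MochizukiFrdI2008, Def. 1.2 (iii) p.22] -/
theorem isIso_of_isCoAngularPreStep_of_isGroupLikeObj {A B : C₁}
    (hA : (PreFrobenioidData.ofFunctor Φ₁ F₁).IsGroupLikeObj A) {φ : A ⟶ B}
    (hφ : (PreFrobenioidData.ofFunctor Φ₁ F₁).IsCoAngularPreStep φ) : IsIso φ :=
  hφ.1 (𝟙 A) φ (𝟙 B) (by simp) ((PreFrobenioidData.ofFunctor Φ₁ F₁).degFr_id B)
    ⟨hφ.2, isIsometry_of_isGroupLikeObj hA φ⟩ (Or.inl (PreFrobenioid.isBaseIso_of_isIso F₁ _))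

/-- **Thm. 3.4 (ii) on the group-like-type branch** (quasi-isotropic type, ANY bases): `Ψ` preserves
pre-steps (isometric here, Thm. 3.4 (i)), co-angular pre-steps (isomorphisms here) and group-like objects
(all objects of `C₂`). [cite: MochizukiFrdI2008, Thm. 3.4 (ii) p.62] -/
theorem thm34ii_conclusion_of_isOfGroupLikeType (hF₁ : PreFrobenioid.IsFrobenioid F₁)
    (hF₂ : PreFrobenioid.IsFrobenioid F₂) (hq₁ : (PreFrobenioidData.ofFunctor Φ₁ F₁).IsOfQuasiIsotropicType)
    (hq₂ : (PreFrobenioidData.ofFunctor Φ₂ F₂).IsOfQuasiIsotropicType)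
    (hg₁ : (PreFrobenioidData.ofFunctor Φ₁ F₁).IsOfGroupLikeType)
    (hg₂ : (PreFrobenioidData.ofFunctor Φ₂ F₂).IsOfGroupLikeType) (Ψ : C₁ ≌ C₂) :
    PreFrobenioidData.PreservesMor Ψ.functor (PreFrobenioidData.ofFunctor Φ₁ F₁).IsPreStep
        (PreFrobenioidData.ofFunctor Φ₂ F₂).IsPreStep ∧
      PreFrobenioidData.PreservesMor Ψ.functor (PreFrobenioidData.ofFunctor Φ₁ F₁).IsCoAngularPreStep
        (PreFrobenioidData.ofFunctor Φ₂ F₂).IsCoAngularPreStep ∧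
      PreFrobenioidData.PreservesObj Ψ.functor (PreFrobenioidData.ofFunctor Φ₁ F₁).IsGroupLikeObj
        (PreFrobenioidData.ofFunctor Φ₂ F₂).IsGroupLikeObj := by
  have hP₂ := hF₂.isPreFrobenioid
  refine ⟨fun A B φ hφ => ?_, fun A B φ hφ => ?_, fun A _ => hg₂.obj _⟩
  · exact (isIsometry_isPreStep_map hF₁ hF₂ hq₁ hq₂ Ψ (isIsometry_of_isGroupLikeObj (hg₁.obj A) φ) hφ).2
  · haveI : IsIso φ := isIso_of_isCoAngularPreStep_of_isGroupLikeObj (hg₁.obj A) hφ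
    refine ⟨?_, PreFrobenioid.isPreStep_of_isIso F₂ _⟩
    rw [PreFrobenioidData.ofFunctor_isCoAngular]
    exact PreFrobenioid.isCoAngular_of_isIso F₂ hP₂.isTotallyEpimorphic _

/-- **The typed `PreFrobenioidData.Thm34ii` at `ofFunctor`, group-like-type branch** (its FSMFF-type
hypotheses are accepted and not used). [cite: MochizukiFrdI2008, Thm. 3.4 (ii) p.62] -/
theorem thm34ii_ofFunctor_of_isOfGroupLikeType (hF₁ : PreFrobenioid.IsFrobenioid F₁)
    (hF₂ : PreFrobenioid.IsFrobenioid F₂) (hg₁ : (PreFrobenioidData.ofFunctor Φ₁ F₁).IsOfGroupLikeType)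
    (hg₂ : (PreFrobenioidData.ofFunctor Φ₂ F₂).IsOfGroupLikeType) (Ψ : C₁ ≌ C₂) :
    (PreFrobenioidData.ofFunctor Φ₁ F₁).Thm34ii (PreFrobenioidData.ofFunctor Φ₂ F₂) Ψ :=
  fun hq₁ hq₂ _ _ => thm34ii_conclusion_of_isOfGroupLikeType hF₁ hF₂ hq₁ hq₂ hg₁ hg₂ Ψ

/-- **The typed `PreFrobenioidData.Thm34iii` at `ofFunctor`, group-like-type branch**: standard type (a)
gives quasi-isotropic type, hypothesis (b) `HypB` gives "`Ψ`, `Ψ⁻¹` preserve base-isomorphisms", and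
`FrdI.thm34iii_of_isOfGroupLikeType_of_hypB` gives the seven morphism classes and `Ψ^{ℕ≥1}`.
[cite: MochizukiFrdI2008, Thm. 3.4 (iii) p.62] -/
theorem thm34iii_ofFunctor_of_isOfGroupLikeType (hF₁ : PreFrobenioid.IsFrobenioid F₁)
    (hF₂ : PreFrobenioid.IsFrobenioid F₂) (hg₁ : (PreFrobenioidData.ofFunctor Φ₁ F₁).IsOfGroupLikeType)
    (hg₂ : (PreFrobenioidData.ofFunctor Φ₂ F₂).IsOfGroupLikeType) (Ψ : C₁ ≌ C₂) :
    (PreFrobenioidData.ofFunctor Φ₁ F₁).Thm34iii (PreFrobenioidData.ofFunctor Φ₂ F₂) Ψ :=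
  fun hs₁ hs₂ hb => thm34iii_of_isOfGroupLikeType_of_hypB hF₁ hF₂ hs₁.quasiIsotropic hs₂.quasiIsotropic
    hg₁ hg₂ Ψ hb

end Two

end FrdI

end Literature.AlgebraicGeometry.Frobenioids
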